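import Summits.Langlands.Langlands.Theorems.AbelianSurfaceSerreSerreGSp4SurjectiveSingerFamilyDefs
import Summits.Langlands.Langlands.Theorems.AbelianSurfaceSerreSerreGSp4SurjectiveStubIrredOnCycKernel
import Literature.NumberTheory.GaloisRepresentations.CrystallineOrdinary
import Literature.NumberTheory.GaloisRepresentations.OrdinaryCrystallineSymplecticLift
import Literature.NumberTheory.GaloisRepresentations.OrdinaryCrystallineSymplecticLiftNonGeneric
import Literature.NumberTheory.GaloisRepresentations.FKP2021GeometricLiftGSp4Rational
import Summits.Langlands.Langlands.Theorems.RamifiedCoefficientSeedAdjointLiftingGL3StubInertiaOrderTeichHelpers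
import HarnessLib

/-!
# Crux `SerreGSp4Surjective` (stmt-Langlands-17765), line `singer-type-evaporation`:
# stub 2/7 `stub_liftExists` — existence of the crystalline-ordinary symplectic `p`-adic lift,
# conditional on the vendored named facts (Gee–Geraghty 2012 Lemma 7.6.7 / Yamauchi 2020 §9.4.1,
# local; Fakhruddin–Khare–Patrikis 2021 Thm. A with Gee–Geraghty Lemma 7.2.3, global)

Registered signature (skeleton v8/v9):
`∃ p₁, ∀ p ≥ p₁, ∀ ρ̄ : Γ_ℚ → GL₄(𝔽_p), FullSymplecticImage p ρ̄ → OrdinaryDistinguishedAt p ρ̄ →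
Nonempty (OrdinaryLift p ρ̄)`.

This stub is "in print" only as a CHAIN of theorems; the chain is vendored as named facts
(D-0014) in `Literature/NumberTheory/GaloisRepresentations/`:
* `GeeGeraghty2012_lem767_ordinarySymplecticLift_rat` (p170640) — LOCAL, generic case: a
  `p`-distinguished ordinary symplectic `ρ̄|Γ_{ℚ_p}` none of whose diagonal character ratios is `ε̄`
  has a crystalline ordinary symplectic lift with multiplier `ε⁻¹` (Gee–Geraghty, Lemma 7.6.7);
* `Yamauchi2020_sec941_ordinarySymplecticLift_rat` — LOCAL, the same WITHOUT genericity (Yamauchi's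
  preprint, §9.4.1; the one link whose printed proof is only a sketch — see that file's CAVEAT);
* `FKP2021_thmA_ordinaryCrystallineLift_GSp4_rat` — GLOBAL: an odd `ρ̄ : Γ_ℚ → GSp₄(𝔽_p)`
  irreducible on `Γ_{ℚ(ζ_p)}` with such a local lift at `p` has, for `p ≫ 0`, a geometric lift
  `r : Γ_ℚ → GSp₄(ℚ̄_p)` unramified a.e., multiplier EXACTLY `ε⁻¹`, crystalline-ordinary at `p`
  with the same exponents (Fakhruddin–Khare–Patrikis Thm. A for `G = GSp₄/ℚ`, the ordinary
  components being Gee–Geraghty's Lemma 7.2.3).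
The interface between the local and the global fact is the accepted
`IsOrdinarySymplecticLocalLiftAt` (p170640).

Proved here, sorry-free:
* `stub_liftExists_of : Yamauchi2020_… → FKP2021_… → <registered body, verbatim>` — the stub
  modulo the two facts (`p₁ = max p₀ 3`, `p₀` the bound of the global fact);
* `stub_liftExists_generic_of : GeeGeraghty2012_… → FKP2021_… → <registered body with the extra
  hypothesis OrdinaryGenericAt p ρ̄>` — the same through the RIGOROUSLY printed local lemma, for
  `ρ̄` whose triangular form at `p` is generic (`OrdinaryGenericAt`, defined here: (H2) at `v`
  together with `d_i ≠ ε̄ d_j` for all `i ≠ j` in the same frame).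
Glue (all kernel-checked): (H1) gives `J` and the multiplier clause verbatim and, with the landed
`stub_irredOnCycKernel` (p164826, `p ≥ 3`), irreducibility on `Γ_{ℚ(ζ_p)}`; (H2) at the place `v₀`
above `p` is the local fact's hypothesis verbatim; `v₀` is the ONLY place above `p`
(`eq_of_natCast_mem_asIdeal`, via Mathlib's `Rat.HeightOneSpectrum.primesEquiv`; existence is the landed
`AdjointLiftingGL3.Birth.exists_heightOneSpectrum_natCast_mem`, reused), so the local
datum serves every `v ∣ p`; the global fact's output is repackaged as an `OrdinaryLift` with
`b = -e` (strictly increasing), `wts = {-e_i}` (four distinct integers in `[-e₀, -e₃]`), and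
`PotentiallyCrystallineAt` follows from crystallinity (de Rham, and `N = 0` transported along the
datum's uniqueness of the Weil–Deligne representation, `potentiallyCrystallineAt_of_isCrystallineFramed`).
No twist is needed: the local exponents are chosen with `e₀ + e₃ = e₁ + e₂ = -1`, so the multiplier
is `ε⁻¹` from the start.

References: Gee–Geraghty, Duke Math. J. 161 (2012), Lemma 7.6.7, Lemma 7.2.3; Fakhruddin–Khare–
Patrikis, Duke Math. J. 170 (2021), Thm. A (= Thm. 6.11 of arXiv:1904.02374), Rem. 6.16;
T. Yamauchi, arXiv:2006.07824, §9.4.1; Barnet-Lamb–Gee–Geraghty–Taylor 2014, §1.4.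
-/

set_option linter.dupNamespace false -- `Summit.Langlands.Langlands` is the mandated namespace

namespace Summit.Langlands.Langlands.Cruxes.SerreGSp4Surjective.SingerTypeEvaporation

open Literature.NumberTheory.GaloisRepresentations Literature.NumberTheory.Automorphic
  Literature.NumberTheory.PAdicHodge
open scoped NumberField
open IsDedekindDomain Polynomial Filter

noncomputable section

/-! ## Genericity at `p` (the extra hypothesis of the rigorous variant) -/

/-- **(H2) together with genericity at `p`**: at every `v ∣ p`, in SOME frame `g` over `𝔽̄_p`,
`ρ̄|Γ_{ℚ_v}` is upper triangular with diagonal characters `d₀, …, d₃` that are pairwise distinct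
(verbatim the clause of `OrdinaryDistinguishedAt`) AND generic: `d_i ≠ ε̄_p · d_j` for all `i ≠ j`
(no ratio of two of them is the mod-`p` cyclotomic character) — the hypothesis under which
Gee–Geraghty's Lemma 7.6.7 (`GeeGeraghty2012_lem767_ordinarySymplecticLift_rat`) supplies the local
lift (a HYPOTHESIS predicate of this line, nothing asserted).  It implies `OrdinaryDistinguishedAt p ρ̄`.
[folklore] -/
def OrdinaryGenericAt (p : ℕ) [Fact p.Prime] (ρ : FramedGaloisRep ℚ (ZMod p) 4) : Prop :=
  ∀ v : HeightOneSpectrum (𝓞 ℚ), ((p : ℕ) : 𝓞 ℚ) ∈ v.asIdeal →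
    ∃ g : GL (Fin 4) (AlgebraicClosure (ZMod p)),
      (∀ (τ : Field.absoluteGaloisGroup (v.adicCompletion ℚ)) (i j : Fin 4), j < i →
        (g.val * ((ρ.toLocal v τ).val.map (algebraMap (ZMod p) (AlgebraicClosure (ZMod p)))) *
          (g⁻¹).val) i j = 0) ∧
      (∀ i j : Fin 4, i ≠ j → ∃ τ : Field.absoluteGaloisGroup (v.adicCompletion ℚ),
        (g.val * ((ρ.toLocal v τ).val.map (algebraMap (ZMod p) (AlgebraicClosure (ZMod p)))) *
            (g⁻¹).val) i i ≠
          (g.val * ((ρ.toLocal v τ).val.map (algebraMap (ZMod p) (AlgebraicClosure (ZMod p)))) *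
            (g⁻¹).val) j j) ∧
      (∀ i j : Fin 4, i ≠ j → ∃ τ : Field.absoluteGaloisGroup (v.adicCompletion ℚ),
        (g.val * ((ρ.toLocal v τ).val.map (algebraMap (ZMod p) (AlgebraicClosure (ZMod p)))) *
            (g⁻¹).val) i i ≠
          algebraMap (ZMod p) (AlgebraicClosure (ZMod p))
              ((modPCyclotomicCharacterZMod ℚ p (absGaloisRestrict ℚ (v.adicCompletion ℚ) τ) :
                (ZMod p)ˣ) : ZMod p) *
            (g.val * ((ρ.toLocal v τ).val.map (algebraMap (ZMod p) (AlgebraicClosure (ZMod p)))) *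
              (g⁻¹).val) j j)

/-- Genericity at `p` (which carries the triangular form) implies (H2). [folklore] -/
theorem OrdinaryGenericAt.ordinaryDistinguishedAt {p : ℕ} [Fact p.Prime]
    {ρ : FramedGaloisRep ℚ (ZMod p) 4} (h : OrdinaryGenericAt p ρ) :
    OrdinaryDistinguishedAt p ρ := fun v hv => by
  obtain ⟨g, htri, hdist, -⟩ := h v hv
  exact ⟨g, htri, hdist⟩

/-! ## The place of `ℚ` above `p`

Existence of a place above `p` is the landed
`Summit.Langlands.Langlands.Cruxes.AdjointLiftingGL3.Birth.exists_heightOneSpectrum_natCast_mem`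
(imported, reused); uniqueness follows from the landed `natGenerator_eq_of_natCast_mem'` there. -/

/-- There is only ONE place of `ℚ` above `p` (both have `natGenerator = p`, landed
`natGenerator_eq_of_natCast_mem'`; Mathlib's `primesEquiv` is injective). [folklore] -/
theorem eq_of_natCast_mem_asIdeal (p : ℕ) [Fact p.Prime] {v w : HeightOneSpectrum (𝓞 ℚ)}
    (hv : ((p : ℕ) : 𝓞 ℚ) ∈ v.asIdeal) (hw : ((p : ℕ) : 𝓞 ℚ) ∈ w.asIdeal) : v = w := by
  apply Rat.HeightOneSpectrum.primesEquiv.injective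
  exact Subtype.ext
    ((Summit.Langlands.Langlands.Cruxes.AdjointLiftingGL3.Birth.natGenerator_eq_of_natCast_mem'
        Fact.out hv).trans
      (Summit.Langlands.Langlands.Cruxes.AdjointLiftingGL3.Birth.natGenerator_eq_of_natCast_mem'
        Fact.out hw).symm)

/-! ## Crystalline ⇒ de Rham with `N = 0` -/

/-- **Crystalline for the pinned datum implies `PotentiallyCrystallineAt`**: de Rham (part of
`IsCrystallineFramed`), and `N = 0` on EVERY attached Weil–Deligne representation — the datum
attaches one with `N = 0`, any other is isomorphic to it (`PstWeilDeligneData.isEquivalent`), and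
`N = 0` is an isomorphism invariant (the argument of
`WeilDeligneRep.IsEquivalent.N_eq_zero` in `Literature/Barriers/Langlands/MonodromyNotClosedUnderPadicLimits`,
inlined — adapted from there). [folklore] -/
theorem potentiallyCrystallineAt_of_isCrystallineFramed {p : ℕ} [Fact p.Prime]
    (r : FramedGaloisRep ℚ (PadicAlgCl p) 4)
    (h : ∀ (v : HeightOneSpectrum (𝓞 ℚ)) (hv : ((p : ℕ) : 𝓞 ℚ) ∈ v.asIdeal),
      (fontainePstAdicCompletion v p hv).IsCrystallineFramed (r.toLocal v)) :
    PotentiallyCrystallineAt p r := by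
  intro v hv
  obtain ⟨hdR, W₀, hW₀, hN, -⟩ := h v hv
  refine ⟨hdR, fun W hW => ?_⟩
  obtain ⟨eqv⟩ := (fontainePstAdicCompletion v p hv).isEquivalent _ W₀ W hW₀ hW
  have hc := eqv.comm_N
  rw [hN, LinearMap.comp_zero] at hc
  refine LinearMap.ext fun x => ?_
  obtain ⟨y, rfl⟩ := eqv.toRepEquiv.toLinearEquiv.surjective x
  have := congr($hc.symm y)
  simpa using this

/-! ## Assembling an `OrdinaryLift` from the output of the global fact -/

/-- **The `OrdinaryLift` assembled from a global lift as delivered by the global fact**: `b = -e`,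
`wts = {-e₀, -e₁, -e₂, -e₃} ⊂ [-e₀, -e₃]`. [folklore] -/
def ordinaryLiftOfGlobal {p : ℕ} [Fact p.Prime] {ρ : FramedGaloisRep ℚ (ZMod p) 4}
    (r : FramedGaloisRep ℚ (PadicAlgCl p) 4) (e : Fin 4 → ℤ) (he : StrictAnti e)
    (hunr : ∀ᶠ v : HeightOneSpectrum (𝓞 ℚ) in cofinite, r.IsUnramifiedAt v)
    (hsymp : r.IsSymplecticWithMultiplierFun (cycInv p)) (hred : ReducesTo p r ρ)
    (hatp : ∀ (v : HeightOneSpectrum (𝓞 ℚ)) (hv : ((p : ℕ) : 𝓞 ℚ) ∈ v.asIdeal),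
      (fontainePstAdicCompletion v p hv).IsCrystallineFramed (r.toLocal v) ∧
      (letI := (fontainePstAdicCompletion v p hv).algebra
       ∀ τ : v.adicCompletion ℚ →ₐ[ℚ_[p]] PadicAlgCl p,
        r.labelledHodgeTateWeightsAt v (fontainePstAdicCompletion v p hv).algebra
          (fontainePstAdicCompletion v p hv).𝔅 τ.toRingHom = (Finset.univ.val.map fun i => -(e i))) ∧
      FramedRep.IsCrystallineOrdinaryOfExponents p (r.toLocal v) e) :
    OrdinaryLift p ρ where
  lift := r
  b := fun i => -(e i)
  b_strictMono := fun _ _ hij => neg_lt_neg (he hij)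
  wts := Finset.univ.val.map fun i => -(e i)
  lo := -(e 0)
  hi := -(e 3)
  wts_nodup := Multiset.Nodup.map (fun _ _ h => he.injective (neg_injective h)) Finset.univ.nodup
  wts_card := by simp
  wts_range := fun x hx => by
    obtain ⟨i, -, rfl⟩ := Multiset.mem_map.mp hx
    exact ⟨neg_le_neg (he.antitone (Fin.zero_le i)), neg_le_neg (he.antitone (Fin.le_last i))⟩
  lift_symplectic := hsymp
  lift_unramified := hunr
  lift_crystalline := fun v hv => ⟨(hatp v hv).1, (hatp v hv).2.1⟩
  lift_potCrystalline := potentiallyCrystallineAt_of_isCrystallineFramed r fun v hv => (hatp v hv).1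
  lift_ordinary := fun v hv => by simpa only [neg_neg] using (hatp v hv).2.2
  lift_reducesTo := hred

/-! ## The stub, conditional on the named facts -/

/-- **`stub_liftExists` modulo the named facts, rigorous-local form** (Gee–Geraghty Lemma 7.6.7 +
Fakhruddin–Khare–Patrikis Thm. A): for `p ≥ max p₀ 3` every `ρ̄` with (H1), (H2) and GENERIC at `p`
(`OrdinaryGenericAt`) has an `OrdinaryLift`.  (H1) gives the form `J` with multiplier `ε̄⁻¹` and,
by the landed `stub_irredOnCycKernel`, irreducibility on `Γ_{ℚ(ζ_p)}`; the local fact at the unique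
place above `p` gives the exponents `e` and the local lift; the global fact gives `r`, assembled by
`ordinaryLiftOfGlobal`. [cite: GeeGeraghty2012, Lemma 7.6.7] [cite: FakhruddinKharePatrikis2021, Thm. A] -/
theorem stub_liftExists_generic_of (hL : GeeGeraghty2012_lem767_ordinarySymplecticLift_rat)
    (hG : FKP2021_thmA_ordinaryCrystallineLift_GSp4_rat) :
    ∃ p₁ : ℕ, ∀ (p : ℕ) [Fact p.Prime], p₁ ≤ p → ∀ ρ : FramedGaloisRep ℚ (ZMod p) 4,
      FullSymplecticImage p ρ → OrdinaryDistinguishedAt p ρ → OrdinaryGenericAt p ρ →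
        Nonempty (OrdinaryLift p ρ) := by
  obtain ⟨p₀, hG⟩ := hG
  refine ⟨max p₀ 3, fun p _ hp ρ hH1 _hH2 hgen => ?_⟩
  have hp₀ : p₀ ≤ p := (le_max_left _ _).trans hp
  have hp3 : 3 ≤ p := (le_max_right _ _).trans hp
  have hirr : IrredOnCycKernel p ρ := stub_irredOnCycKernel p ρ hp3 hH1
  obtain ⟨J, hJt, hJdet, hmult, -⟩ := hH1
  obtain ⟨v₀, hv₀⟩ :=
    Summit.Langlands.Langlands.Cruxes.AdjointLiftingGL3.Birth.exists_heightOneSpectrum_natCast_mem p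
  obtain ⟨e, rv₀, he, hloc₀⟩ := hL p hp3 ρ J hJt hJdet hmult v₀ hv₀ (hgen v₀ hv₀)
  have hloc : ∀ (v : HeightOneSpectrum (𝓞 ℚ)) (hv : ((p : ℕ) : 𝓞 ℚ) ∈ v.asIdeal),
      ∃ rv : FramedRep (Field.absoluteGaloisGroup (v.adicCompletion ℚ)) (PadicAlgCl p) 4,
        IsOrdinarySymplecticLocalLiftAt p ρ J v hv e rv := by
    intro v hv
    obtain rfl : v₀ = v := eq_of_natCast_mem_asIdeal p hv₀ hv
    exact ⟨rv₀, hloc₀⟩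
  obtain ⟨r, hunr, hsymp, hred, hatp⟩ := hG p hp₀ ρ J e hJt hJdet hmult hirr he hloc
  exact ⟨ordinaryLiftOfGlobal r e he hunr hsymp hred hatp⟩

/-- **`stub_liftExists` modulo the named facts — the REGISTERED body verbatim as conclusion**
(Yamauchi §9.4.1 [non-generic local lift] + Fakhruddin–Khare–Patrikis Thm. A): for `p ≥ max p₀ 3`
every `ρ̄` with (H1), (H2) has an `OrdinaryLift`.  Same glue as `stub_liftExists_generic_of`, the
local fact now taking the (H2) clause at the place above `p` verbatim.
[cite: Yamauchi2020, §9.4.1] [cite: FakhruddinKharePatrikis2021, Thm. A] -/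
theorem stub_liftExists_of (hL : Yamauchi2020_sec941_ordinarySymplecticLift_rat)
    (hG : FKP2021_thmA_ordinaryCrystallineLift_GSp4_rat) :
    ∃ p₁ : ℕ, ∀ (p : ℕ) [Fact p.Prime], p₁ ≤ p → ∀ ρ : FramedGaloisRep ℚ (ZMod p) 4,
      FullSymplecticImage p ρ → OrdinaryDistinguishedAt p ρ → Nonempty (OrdinaryLift p ρ) := by
  obtain ⟨p₀, hG⟩ := hG
  refine ⟨max p₀ 3, fun p _ hp ρ hH1 hH2 => ?_⟩
  have hp₀ : p₀ ≤ p := (le_max_left _ _).trans hp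
  have hp3 : 3 ≤ p := (le_max_right _ _).trans hp
  have hirr : IrredOnCycKernel p ρ := stub_irredOnCycKernel p ρ hp3 hH1
  obtain ⟨J, hJt, hJdet, hmult, -⟩ := hH1
  obtain ⟨v₀, hv₀⟩ :=
    Summit.Langlands.Langlands.Cruxes.AdjointLiftingGL3.Birth.exists_heightOneSpectrum_natCast_mem p
  obtain ⟨e, rv₀, he, hloc₀⟩ := hL p hp3 ρ J hJt hJdet hmult v₀ hv₀ (hH2 v₀ hv₀)
  have hloc : ∀ (v : HeightOneSpectrum (𝓞 ℚ)) (hv : ((p : ℕ) : 𝓞 ℚ) ∈ v.asIdeal),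
      ∃ rv : FramedRep (Field.absoluteGaloisGroup (v.adicCompletion ℚ)) (PadicAlgCl p) 4,
        IsOrdinarySymplecticLocalLiftAt p ρ J v hv e rv := by
    intro v hv
    obtain rfl : v₀ = v := eq_of_natCast_mem_asIdeal p hv₀ hv
    exact ⟨rv₀, hloc₀⟩
  obtain ⟨r, hunr, hsymp, hred, hatp⟩ := hG p hp₀ ρ J e hJt hJdet hmult hirr he hloc
  exact ⟨ordinaryLiftOfGlobal r e he hunr hsymp hred hatp⟩

end

end Summit.Langlands.Langlands.Cruxes.SerreGSp4Surjective.SingerTypeEvaporation
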